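import Literature.Probability.LatticeModels.RandomClusterLimitExistence
import Literature.Probability.LatticeModels.RandomClusterFreePercolationProbability
import Literature.Probability.Percolation.LocalLimitConnections
import HarnessLib

/-!
# `θ^b(p,q) = φ^b_{p,q}(0 ↔ ∞)`: the percolation probabilities of the tree are the infinite-volume probabilities
# of `{0 ↔ ∞}` under the limit random-cluster measures (Grimmett 2006, (5.1), (5.3), Prop. (5.11))

Topic `Literature/Probability/LatticeModels`; theorems only (no definitions, no named facts, no sorries).
The tree defines the percolation probabilities of the random-cluster model on `ℤ^d` by finite-volume formulas —
`thetaWired d p q = inf_n φ¹_{Λ_n,p,q}(0 ↔ ∂Λ_n)` (`RandomClusterFirstOrder.lean`) and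
`thetaFree d p q = inf_n sup_k φ⁰_{Λ_{n+k},p,q}(0 ↔ ∂Λ_n)` (`RandomClusterFreePercolationProbability.lean`) — and both
files record that the identification with Grimmett's `θ^b(p,q) = φ^b_{p,q}(0 ↔ ∞)` "stays informal" because the
infinite-volume measure was not in the tree.  With `IsRandomClusterLimit` (`RandomClusterInfiniteVolume.lean`) and its
existence (`RandomClusterLimitExistence.lean`, Thm. (4.19)(a)) this file makes it a theorem:

> Grimmett 2006, §5.1, (5.1): "`θ^b(p,q) = φ^b_{p,q}(0 ↔ ∞)`, `b = 0, 1`"; (5.3) and Prop. (5.11), p. 100: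
> "`θ¹(p,q) = lim_{Λ ↑ ℤ^d} φ¹_{Λ,p,q}(0 ↔ ∂Λ)`" (proof: `{0 ↔ ∂Λ} ↓ {0 ↔ ∞}`, and (4.24)).

* `toLattice_preimage_siteToBoundary` — the lattice event `{0 ↔ ∂Λ_n in Λ_n}` read on the box `Λ_n` is the box event
  `originToBoundary d n` of the tree.
* `measure_percolatesAt_eq_iInf_siteToBoundary` — for every finite measure carried by lattice configurations,
  `μ(0 ↔ ∞) = inf_n μ(0 ↔ ∂Λ_n)` (`{0 ↔ ∂Λ_n}` decrease a.s. to `{0 ↔ ∞}`).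
* **`IsRandomClusterLimit.real_siteToBoundary_eq_thetaFreeArm`**, **`IsRandomClusterLimit.real_percolatesAt_eq_thetaFree`**
  — for the free limit `φ⁰_{p,q}` (`0 ≤ p ≤ 1`, `q ≥ 1`): `φ⁰_{p,q}(0 ↔ ∂Λ_n) = thetaFreeArm d p q n` and
  **`φ⁰_{p,q}(0 ↔ ∞) = thetaFree d p q = θ⁰(p,q)`** ((5.1), `b = 0`).
* **`IsRandomClusterLimit.real_percolatesAt_eq_thetaWired`** — for the wired limit `φ¹_{p,q}` (`d ≥ 1`):
  **`φ¹_{p,q}(0 ↔ ∞) = thetaWired d p q = θ¹(p,q)`** ((5.3), Prop. (5.11)); with the sandwich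
  `φ¹_{Λ_{n+k}}(0 ↔ ∂Λ_{n+k}) ≤ φ¹_{Λ_{n+k}}(0 ↔ ∂Λ_n) ≤ φ¹_{Λ_n}(0 ↔ ∂Λ_n)` ((4.24) and the event inclusion of Prop. (5.11)).
* `exists_isRandomClusterLimit_real_percolatesAt_eq_thetaWired/_thetaFree` — packaged with existence.

## References

* G. Grimmett, *The Random-Cluster Model*, Springer 2006, §5.1 (5.1)–(5.4), Prop. (5.11); Thm. (4.19)(a) and (4.24).
  [Grimmett2006]
-/

noncomputable section

open MeasureTheory Filter Topology Set
open scoped ENNReal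

namespace Literature.Probability.LatticeModels

open Literature.Probability.Percolation Literature.Probability.Percolation.DCT16 Literature.Barriers.CriticalPhenomena

variable {d : ℕ}

/-! ### The one-arm event read on the box -/

/-- The open graph of a box configuration read on the lattice, induced on the box, is the open graph of the box
configuration. [folklore] -/
private theorem induce_openGraph_toLattice (Λ : Finset (Site d)) (ω : BondConfig ↥Λ) :
    (openGraph (toLattice Λ ω)).induce (↑Λ : Set (Site d)) = openGraph ω := by
  ext a b
  simp only [SimpleGraph.induce, SimpleGraph.comap_adj, Function.Embedding.coe_subtype, openGraph_adj,
    mem_toLattice_iff, ne_eq]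
  constructor
  · rintro ⟨⟨e', he', hmap⟩, hne⟩
    have : e' = s(a, b) := Sym2.map.injective Subtype.val_injective (by rw [hmap, Sym2.map_mk])
    exact ⟨this ▸ he', fun h => hne (congrArg Subtype.val h)⟩
  · rintro ⟨hab, hne⟩
    exact ⟨⟨s(a, b), hab, by rw [Sym2.map_mk]⟩, fun h => hne (Subtype.ext h)⟩

/-- **The lattice one-arm event `{0 ↔ ∂Λ_n in Λ_n}` read on the box `Λ_n` is the tree's box event
`originToBoundary d n`.** [cite: Grimmett2006, Prop. (5.11) (the events `{0 ↔ ∂Λ}`)] -/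
theorem toLattice_preimage_siteToBoundary (n : ℕ) :
    toLattice (box d n) ⁻¹' siteToBoundary d n = originToBoundary d n := by
  ext ω
  simp only [mem_preimage, siteToBoundary, openConnIn, originToBoundary, boxBoundary, mem_setOf_eq]
  constructor
  · rintro ⟨y, hy, hx, hy', hreach⟩
    refine ⟨⟨y, hy'⟩, hy, ?_⟩
    have h := hreach
    rw [induce_openGraph_toLattice] at h
    exact h
  · rintro ⟨y, hy, hreach⟩
    refine ⟨y.1, hy, (boxOrigin d n).2, y.2, ?_⟩
    rw [induce_openGraph_toLattice]
    exact hreach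

/-- The window of `{0 ↔ ∂Λ_n}` lies in `Λ_n`. [folklore] -/
private theorem sym2_box_window (n : ℕ) : ∀ e ∈ (↑((box d n).sym2) : Set (Sym2 (Site d))), ∀ x ∈ e, x ∈ box d n :=
  fun _ he _ hx => Finset.mem_sym2_iff.1 (Finset.mem_coe.1 he) _ hx

/-- **The box law of `{0 ↔ ∂Λ_n}` in the box `Λ_{n+k}`** is the tree's finite-volume quantity:
`φ^W_{Λ_{n+k}}(0 ↔ ∂Λ_n) = φ^W_{Λ_{n+k}}(ρ⁻¹(originToBoundary d n))`. [cite: Grimmett2006, Prop. (5.11)] -/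
theorem rcBoxLaw_real_siteToBoundary (b : RCBoundary) (p q : ℝ) (n k : ℕ) :
    (rcBoxLaw d b p q (n + k)).real (siteToBoundary d n) =
      (rcMeasure (finsetGraph (zdGraph d) (box d (n + k))) p q (b.wiredSet (box d (n + k)))).real
        (finsetRestrict (box_mono d (Nat.le_add_right n k)) ⁻¹' originToBoundary d n) := by
  rw [rcBoxLaw_real_apply b p q _ (measurableSet_siteToBoundary d n),
    toLattice_preimage_eq_finsetRestrict_preimage (Nat.le_add_right n k) (determinedBy_siteToBoundary d n)
      (sym2_box_window n), toLattice_preimage_siteToBoundary]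

/-! ### `{0 ↔ ∂Λ_n} ↓ {0 ↔ ∞}` almost surely -/

/-- For a lattice configuration, `{0 ↔ ∂Λ_n}` forces `{0 ↔ ∂Λ_m}` for `m ≤ n`. [cite: Grimmett2006, Prop. (5.11) (proof)] -/
private theorem siteToBoundary_anti_of_subset {m n : ℕ} (hmn : m ≤ n) {ω : BondConfig (Site d)}
    (hω : ω ⊆ (zdGraph d).edgeSet) (h : ω ∈ siteToBoundary d n) : ω ∈ siteToBoundary d m := by
  rw [← armEvent_zero] at h ⊢
  obtain ⟨y, hy, hpath⟩ := h
  rw [sub_zero] at hy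
  refine armEvent_of_pathIn hω (pathIn_of_mem_openConnIn hpath) ?_
  rcases hmn.lt_or_eq with hlt | rfl
  · exact Or.inl (by rw [sub_zero]; exact notMem_box_of_mem_innerBoundary_box hlt hy)
  · exact Or.inr (by rw [sub_zero]; exact hy)

/-- For a lattice configuration, `{0 ↔ ∞}` forces `{0 ↔ ∂Λ_n}` for every `n`. [cite: Grimmett2006, §5.1 (5.3)] -/
private theorem siteToBoundary_of_percolatesAt {ω : BondConfig (Site d)} (hω : ω ⊆ (zdGraph d).edgeSet)
    (h : ω ∈ percolatesAt (0 : Site d)) (n : ℕ) : ω ∈ siteToBoundary d n := by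
  obtain ⟨x, hxC, hx⟩ := Set.Infinite.exists_notMem_finset h (box d n)
  rw [← armEvent_zero]
  exact armEvent_of_pathIn hω (pathIn_univ_of_reachable hxC) (Or.inl (by rwa [sub_zero]))

/-- **`μ(0 ↔ ∞) = inf_n μ(0 ↔ ∂Λ_n)`** for every finite measure carried by lattice configurations (the events
`{0 ↔ ∂Λ_n}` decrease almost surely to `{0 ↔ ∞}`). [cite: Grimmett2006, §5.1 (5.3)] -/
theorem measure_percolatesAt_eq_iInf_siteToBoundary (μ : Measure (BondConfig (Site d))) [IsFiniteMeasure μ]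
    (hae : ∀ᵐ ω ∂μ, ω ⊆ (zdGraph d).edgeSet) :
    μ (percolatesAt 0) = ⨅ n, μ (siteToBoundary d n) := by
  have heq : (percolatesAt (0 : Site d) : Set (BondConfig (Site d))) =ᵐ[μ] (⋂ n, siteToBoundary d n : Set _) := by
    filter_upwards [hae] with ω hω
    refine propext ⟨fun h => mem_iInter.2 (siteToBoundary_of_percolatesAt hω h), fun h => ?_⟩
    exact iInter_siteToBoundary_subset_percolatesAt d h
  rw [measure_congr heq, measure_iInter_eq_iInf_measure_iInter_le
    (fun n => (measurableSet_siteToBoundary d n).nullMeasurableSet) ⟨0, measure_ne_top _ _⟩]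
  refine le_antisymm (le_iInf fun n => (iInf_le _ n).trans (measure_mono (iInter₂_subset (s := fun j (_ : j ≤ n) => siteToBoundary d j) n le_rfl))) ?_
  refine le_iInf fun i => (iInf_le _ i).trans (measure_mono_ae ?_)
  filter_upwards [hae] with ω hω hωi
  exact mem_iInter₂.2 fun j hj => siteToBoundary_anti_of_subset hj hω hωi

/-- The box probabilities `μ(0 ↔ ∂Λ_n)` are non-increasing in `n` (lattice-supported `μ`). [cite: Grimmett2006, Prop. (5.11)] -/
theorem measure_siteToBoundary_antitone (μ : Measure (BondConfig (Site d))) (hae : ∀ᵐ ω ∂μ, ω ⊆ (zdGraph d).edgeSet) :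
    Antitone fun n => μ (siteToBoundary d n) := fun m n hmn =>
  measure_mono_ae (by filter_upwards [hae] with ω hω h using siteToBoundary_anti_of_subset hmn hω h)

/-- `μ(0 ↔ ∂Λ_n) → μ(0 ↔ ∞)` (lattice-supported finite `μ`). [cite: Grimmett2006, §5.1 (5.3)] -/
theorem tendsto_measure_siteToBoundary (μ : Measure (BondConfig (Site d))) [IsFiniteMeasure μ]
    (hae : ∀ᵐ ω ∂μ, ω ⊆ (zdGraph d).edgeSet) :
    Tendsto (fun n => μ (siteToBoundary d n)) atTop (𝓝 (μ (percolatesAt 0))) := by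
  rw [measure_percolatesAt_eq_iInf_siteToBoundary μ hae]
  exact tendsto_atTop_iInf (measure_siteToBoundary_antitone μ hae)

/-- Real-valued form. [cite: Grimmett2006, §5.1 (5.3)] -/
theorem tendsto_measureReal_siteToBoundary (μ : Measure (BondConfig (Site d))) [IsFiniteMeasure μ]
    (hae : ∀ᵐ ω ∂μ, ω ⊆ (zdGraph d).edgeSet) :
    Tendsto (fun n => μ.real (siteToBoundary d n)) atTop (𝓝 (μ.real (percolatesAt 0))) :=
  (ENNReal.tendsto_toReal (measure_ne_top _ _)).comp (tendsto_measure_siteToBoundary μ hae)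

/-! ### The free limit: `φ⁰_{p,q}(0 ↔ ∞) = θ⁰(p,q)` -/

namespace IsRandomClusterLimit

variable {p q : ℝ} {P : Measure (BondConfig (Site d))}

/-- **`φ⁰_{p,q}(0 ↔ ∂Λ_n) = thetaFreeArm d p q n`** (`= sup_k φ⁰_{Λ_{n+k}}(0 ↔ ∂Λ_n)`), `0 ≤ p ≤ 1`, `q ≥ 1`.
[cite: Grimmett2006, §5.1 (5.1) and Thm. (4.19)(a)] -/
theorem real_siteToBoundary_eq_thetaFreeArm (hP : IsRandomClusterLimit d RCBoundary.free p q P)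
    (hp : p ∈ Set.Icc (0 : ℝ) 1) (hq : 1 ≤ q) (n : ℕ) : P.real (siteToBoundary d n) = thetaFreeArm d p q n := by
  have h1 : Tendsto (fun k : ℕ => (rcBoxLaw d RCBoundary.free p q (k + n)).real (siteToBoundary d n)) atTop
      (𝓝 (P.real (siteToBoundary d n))) :=
    (tendsto_add_atTop_iff_nat n).2 (hP.tendsto_real (isLocalEvent_siteToBoundary d n))
  have h2 : Tendsto (fun k : ℕ => (rcBoxLaw d RCBoundary.free p q (k + n)).real (siteToBoundary d n)) atTop
      (𝓝 (thetaFreeArm d p q n)) := by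
    refine (tendsto_thetaFreeBox hp hq n).congr fun k => ?_
    rw [add_comm, rcBoxLaw_real_siteToBoundary, thetaFreeBox_eq_real]
    rfl
  exact tendsto_nhds_unique h1 h2

/-- **`φ⁰_{p,q}(0 ↔ ∞) = θ⁰(p,q)`** (Grimmett's (5.1), `b = 0`): the tree's `thetaFree d p q` is the probability of
`{0 ↔ ∞}` under the free infinite-volume measure. [cite: Grimmett2006, §5.1 (5.1)] -/
theorem real_percolatesAt_eq_thetaFree (hP : IsRandomClusterLimit d RCBoundary.free p q P)
    (hp : p ∈ Set.Icc (0 : ℝ) 1) (hq : 1 ≤ q) : P.real (percolatesAt 0) = thetaFree d p q := by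
  haveI := hP.isProbabilityMeasure
  have hae := hP.ae_subset_edgeSet hp (one_pos.trans_le hq)
  have h1 := tendsto_measureReal_siteToBoundary P hae
  have h2 : Tendsto (fun n => P.real (siteToBoundary d n)) atTop (𝓝 (thetaFree d p q)) := by
    refine (tendsto_thetaFreeArm hp (one_pos.trans_le hq)).congr fun n => ?_
    exact (hP.real_siteToBoundary_eq_thetaFreeArm hp hq n).symm
  exact tendsto_nhds_unique h1 h2

/-! ### The wired limit: `φ¹_{p,q}(0 ↔ ∞) = θ¹(p,q)` -/

/-- The sandwich `φ¹_{Λ_{n+k}}(0 ↔ ∂Λ_{n+k}) ≤ φ¹_{Λ_{n+k}}(0 ↔ ∂Λ_n) ≤ φ¹_{Λ_n}(0 ↔ ∂Λ_n)` ((4.24) and the event inclusion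
of Prop. (5.11)). [cite: Grimmett2006, Prop. (5.11) (proof) and (4.24)] -/
theorem thetaWiredBox_le_rcBoxLaw_real_siteToBoundary (hd : 0 < d) (hp : p ∈ Set.Icc (0 : ℝ) 1) (hq : 1 ≤ q) (n k : ℕ) :
    thetaWiredBox d p q (n + k) ≤ (rcBoxLaw d RCBoundary.wired p q (n + k)).real (siteToBoundary d n) ∧
      (rcBoxLaw d RCBoundary.wired p q (n + k)).real (siteToBoundary d n) ≤ thetaWiredBox d p q n := by
  rw [rcBoxLaw_real_siteToBoundary, RCBoundary.wiredSet_wired]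
  constructor
  · rw [thetaWiredBox_eq_general]
    exact rcMeasure_real_mono_on_edgeSets _ hp (one_pos.trans_le hq) _ fun ω hω hmem =>
      finsetRestrict_mem_originToBoundary (Nat.le_add_right n k) hω hmem
  · rw [thetaWiredBox_eq_general d p q n]
    exact rcMeasure_real_box_restrict_le hd (Nat.le_add_right n k) hp hq (isUpperSet_originToBoundary d n)

/-- **`φ¹_{p,q}(0 ↔ ∞) = θ¹(p,q)`** (Grimmett's (5.3) / Prop. (5.11)): the tree's `thetaWired d p q = inf_n φ¹_{Λ_n}(0 ↔ ∂Λ_n)`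
is the probability of `{0 ↔ ∞}` under the wired infinite-volume measure (`d ≥ 1`, `0 ≤ p ≤ 1`, `q ≥ 1`).
[cite: Grimmett2006, §5.1 (5.3) and Prop. (5.11)] -/
theorem real_percolatesAt_eq_thetaWired (hd : 0 < d) (hP : IsRandomClusterLimit d RCBoundary.wired p q P)
    (hp : p ∈ Set.Icc (0 : ℝ) 1) (hq : 1 ≤ q) : P.real (percolatesAt 0) = thetaWired d p q := by
  haveI := hP.isProbabilityMeasure
  have hae := hP.ae_subset_edgeSet hp (one_pos.trans_le hq)
  -- `φ¹_{p,q}(0 ↔ ∂Λ_n)` is sandwiched: `θ¹ ≤ · ≤ φ¹_{Λ_n}(0 ↔ ∂Λ_n)`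
  have hS : ∀ n, thetaWired d p q ≤ P.real (siteToBoundary d n) ∧ P.real (siteToBoundary d n) ≤ thetaWiredBox d p q n := by
    intro n
    have hconv : Tendsto (fun k : ℕ => (rcBoxLaw d RCBoundary.wired p q (n + k)).real (siteToBoundary d n)) atTop
        (𝓝 (P.real (siteToBoundary d n))) := by
      have := (tendsto_add_atTop_iff_nat n).2 (hP.tendsto_real (isLocalEvent_siteToBoundary d n))
      exact this.congr fun k => by rw [add_comm]
    have hlow : Tendsto (fun k : ℕ => thetaWiredBox d p q (n + k)) atTop (𝓝 (thetaWired d p q)) := by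
      have := (tendsto_add_atTop_iff_nat n).2 (tendsto_thetaWiredBox d hp hq)
      exact this.congr fun k => by rw [add_comm]
    exact ⟨le_of_tendsto_of_tendsto' hlow hconv fun k => (thetaWiredBox_le_rcBoxLaw_real_siteToBoundary hd hp hq n k).1,
      le_of_tendsto' hconv fun k => (thetaWiredBox_le_rcBoxLaw_real_siteToBoundary hd hp hq n k).2⟩
  have h1 := tendsto_measureReal_siteToBoundary P hae
  exact le_antisymm (le_of_tendsto_of_tendsto' h1 (tendsto_thetaWiredBox d hp hq) fun n => (hS n).2)
    (ge_of_tendsto' h1 fun n => (hS n).1)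

end IsRandomClusterLimit

/-- **`θ¹(p,q) = φ¹_{p,q}(0 ↔ ∞)` with existence**: for `d ≥ 1`, `0 ≤ p ≤ 1`, `q ≥ 1` there is a wired limit measure and
its probability of `{0 ↔ ∞}` is `thetaWired d p q`. [cite: Grimmett2006, §5.1 (5.3), Prop. (5.11), Thm. (4.19)(a)] -/
theorem exists_isRandomClusterLimit_real_percolatesAt_eq_thetaWired (hd : 0 < d) {p q : ℝ} (hp : p ∈ Set.Icc (0 : ℝ) 1)
    (hq : 1 ≤ q) : ∃ P : Measure (BondConfig (Site d)), IsRandomClusterLimit d RCBoundary.wired p q P ∧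
      P.real (percolatesAt 0) = thetaWired d p q := by
  obtain ⟨P, hP⟩ := exists_isRandomClusterLimit hd RCBoundary.wired hp hq
  exact ⟨P, hP, hP.real_percolatesAt_eq_thetaWired hd hp hq⟩

/-- **`θ⁰(p,q) = φ⁰_{p,q}(0 ↔ ∞)` with existence** (`d ≥ 1`). [cite: Grimmett2006, §5.1 (5.1), Thm. (4.19)(a)] -/
theorem exists_isRandomClusterLimit_real_percolatesAt_eq_thetaFree (hd : 0 < d) {p q : ℝ} (hp : p ∈ Set.Icc (0 : ℝ) 1)
    (hq : 1 ≤ q) : ∃ P : Measure (BondConfig (Site d)), IsRandomClusterLimit d RCBoundary.free p q P ∧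
      P.real (percolatesAt 0) = thetaFree d p q := by
  obtain ⟨P, hP⟩ := exists_isRandomClusterLimit hd RCBoundary.free hp hq
  exact ⟨P, hP, hP.real_percolatesAt_eq_thetaFree hp hq⟩

end Literature.Probability.LatticeModels
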